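/-
Copyright (c) 2026. All rights reserved.
Released under Apache 2.0 license as described in the file LICENSE.
-/
import Literature.Probability.FitznerVanDerHofstad2017.NobleBoundsNTargets
import Literature.Probability.FitznerVanDerHofstad2017.NobleBoundsNMidStar
import Literature.Probability.FitznerVanDerHofstad2017.NobleBoundsNMidStarZero
import Literature.Probability.FitznerVanDerHofstad2017.NobleBoundsNFirstStar
import HarnessLib

/-!
# Fitzner–van der Hofstad (2017), §6.1 (6.4) / §5.1 (5.4), "Elements of the bounds": the `pkg` DISPATCH at the junctions below a CLOSED level (upper `★`)

[FvdH17] = R. Fitzner, R. van der Hofstad, *Mean-field behavior for nearest-neighbor percolation in `d > 10`*,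
arXiv:1506.07977v2 (EJP 22 (2017), paper 43).  Page numbers refer to the arXiv version.

Companion of `NobleBoundsNDispatchReg` (regular class pairs).  At a junction `k ≤ M` whose UPPER level `k + 1`
is closed (`a_{k+1} = ★`, kind `closed`, (4.58)/(4.62), p. 41) only the variants `F‴` are admissible
(`NobleBoundsNGrouped.AdmV`), the level is pinned (`w_{k+1} = z_{k+1} = u_k`, (4.64), p. 42 —
`JFacts.pin_closedU`), and the column of the extended pointwise family is the CLOSED SECTION
`𝟙{w_{k+1} = u_k} · B_pt^{κ,a₀,0}(u_k,w_k,t_k,z_k,u_{k+1},u_{k+1})` (`NobleBoundsNAssemblyStar.secEcpt`, §5.1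
"Elements of the bounds", p. 49).  This file

* §A: records the pin of a closed upper level (`JFacts.pin_closedU`, twin of `JFacts.w_eq_z_of_inr`);
* §B: defines the upper-`★` TARGET FAMILY `tgtStarU L κ a₀ u w t z w′ u′ v` — the regular family
  `NobleBoundsNTargets.tgtReg` at exit class `0` in the closed section `w′ := u′`, except that on the pin
  `t = u′` the inner-class-`0` variant carries the second term of (5.4) (the `F′`-row of `tgtReg`) — and proves
  `Σ_v tgtStarU ≤ 𝟙{w′ = u} · B'_pt^{κ,a₀,0}(u,w,t,z,u′,u′)` (`sum_tgtStarU_le`, the `hT` hypothesis of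
  `NobleBoundsNGrouped.prod_bondJ_mul_piPerc_jwCover_le_chain_of_packages` on this column);
* §C: dispatches the `pkg` hypothesis at such a junction — middle (`nonempty_jPkg_mid_starU`, onto
  `NobleBoundsNMidStar` / `NobleBoundsNMidStarZero`) and first (`nonempty_jPkg_first_starU`, onto
  `NobleBoundsNFirstStar`, behind the start letter `P^{S,a₀}(u_0,w_0)`).  No hypothesis slot is needed: every
  upper-`★` cell is in the tree.

Conventions: `d`-generic; nothing is cited as a fact; additive (no existing declaration is changed).
-/

noncomputable section

open scoped ENNReal

namespace Literature.Probability.FitznerVanDerHofstad2017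

open Literature.Barriers.CriticalPhenomena Literature.Probability.Percolation
open Literature.Probability.LatticeModels Literature.Combinatorics.SimpleGraph _root_.SimpleGraph
open _root_.MeasureTheory
open Literature.Probability.FitznerVanDerHofstad2017.NobleBlocks
open Literature.Probability.FitznerVanDerHofstad2017.NobleBlocks.LenIdx

variable {d : ℕ}

/-! ### A. The pin of a closed upper level -/

section ClosedUPin

variable {M : ℕ} {x : Site d} {b : Fin (M + 2) → Site d × Site d} {w t z : Fin (M + 2) → Site d}
  {a : Fin (M + 2) → Fin 3 ⊕ Unit} {c : Fin 3 ⊕ Unit} {τ : Fin (M + 1) → Bool × Fin 3}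
  {ω : Fin (M + 3) → BondConfig (Site d)} {K₀ : Fin (M + 3) → Fin 6 → Set (Sym2 (Site d))}

/-- **The pin of a closed upper level**: at a junction `k ≤ M` whose upper level `k + 1` is closed (`a_{k+1} = ★`)
the piece is pinned at that level, `z_{k+1} = u_k` and `w_{k+1} = z_{k+1}` — so the closed section reads
`w_{k+1} = u_k`.  Twin (one junction down) of `JFacts.w_eq_z_of_inr`.
[cite: FitznerVanDerHofstad2017, (4.62), (4.64) (arXiv:1506.07977v2 pp. 41–42)] -/
theorem JFacts.pin_closedU (h : JFacts M x b w t z a c τ ω K₀) (i : Fin (M + 1)) {u₀ : Unit}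
    (ha' : a i.succ = Sum.inr u₀) : z i.succ = (b i.castSucc).1 ∧ w i.succ = z i.succ := by
  have hj := (h.junction i.succ).2
  rw [← Fin.succ_castSucc, pieceViews_closedU M x b w t z a τ i ha',
    (views_succ (x := x) (b := b) (w := w) (a := a) (τ := τ) i.succ).2.1] at hj
  exact hj rfl

/-- The closed section: `w_{k+1} = u_k` below a closed level. [cite: FitznerVanDerHofstad2017, (4.62), (4.64) (arXiv:1506.07977v2 pp. 41–42); §5.1 "Elements of the bounds" (p. 49)] -/
theorem JFacts.w_succ_eq_u_of_closedU (h : JFacts M x b w t z a c τ ω K₀) (i : Fin (M + 1)) {u₀ : Unit}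
    (ha' : a i.succ = Sum.inr u₀) : w i.succ = (b i.castSucc).1 :=
  (h.pin_closedU i ha').2.trans (h.pin_closedU i ha').1

end ClosedUPin

end Literature.Probability.FitznerVanDerHofstad2017

/-! ### B. The upper-`★` target family -/

namespace Literature.Probability.FitznerVanDerHofstad2017.NobleBlocks

open Literature.Probability.LatticeModels

variable {d : ℕ}

section Targets

variable (L : Letters d) (κ : Fin d × Bool) (a₀ : Fin 3) (u w t z w' u' : Site d)

/-- **The upper-`★` target family** of a junction with lower exit class `a₀` below a CLOSED level, indexed by the
variant `v = (σ, c)`: zero off the closed section `w′ = u` and for `σ = true` (inadmissible); otherwise the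
regular target `tgtReg` at exit class `0` with `w′ := u′`, except on the pin `t = u′` at inner class `0`, where
it is the second term `δ_{z,t} A'^{κ,a₀,0}(u,w,u′,t) P^{0}(u′−t,u′−t)` of (5.4).
[cite: FitznerVanDerHofstad2017, §5.1 (5.4) (arXiv:1506.07977v2 p. 48) and "Elements of the bounds" (p. 49); §6.1 (6.4) (p. 58)] -/
def tgtStarU : Bool × Fin 3 → ℝ≥0∞
  | (true, _) => 0
  | (false, c) =>
    if w' = u then
      (if c = 0 ∧ t = u' then tgtReg L κ a₀ 0 u w t z u' u' (true, 0) else tgtReg L κ a₀ 0 u w t z u' u' (false, c))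
    else 0

/-- [cite: FitznerVanDerHofstad2017, §6.1 (6.4) admissible variants (arXiv:1506.07977v2 p. 58)] -/
theorem tgtStarU_true (c : Fin 3) : tgtStarU L κ a₀ u w t z w' u' (true, c) = 0 := rfl

/-- [cite: FitznerVanDerHofstad2017, §5.1 (5.4) (arXiv:1506.07977v2 p. 48)] -/
theorem tgtStarU_false_def (c : Fin 3) :
    tgtStarU L κ a₀ u w t z w' u' (false, c) =
      if w' = u then
        (if c = 0 ∧ t = u' then tgtReg L κ a₀ 0 u w t z u' u' (true, 0) else tgtReg L κ a₀ 0 u w t z u' u' (false, c))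
      else 0 := rfl

/-- [cite: FitznerVanDerHofstad2017, §5.1 (5.4) (arXiv:1506.07977v2 p. 48)] -/
theorem tgtStarU_of_ne (h : w' ≠ u) : ∀ v : Bool × Fin 3, tgtStarU L κ a₀ u w t z w' u' v = 0
  | (true, _) => rfl
  | (false, c) => by rw [tgtStarU_false_def, if_neg h]

/-- On the pin. [cite: FitznerVanDerHofstad2017, §5.1 (5.4) second term (arXiv:1506.07977v2 p. 48)] -/
theorem tgtStarU_pin (hw : w' = u) (ht : t = u') :
    tgtStarU L κ a₀ u w t z w' u' (false, 0) =
      kd z t * (blockAiota' L κ a₀ 0 u w u' t * blockPS L 0 (u' - t) (u' - t)) := by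
  rw [tgtStarU_false_def, if_pos hw, if_pos (⟨rfl, ht⟩ : (0 : Fin 3) = 0 ∧ t = u'), tgtReg_true_zero]

/-- Off the pin. [cite: FitznerVanDerHofstad2017, §5.1 (5.4) first term (arXiv:1506.07977v2 p. 48)] -/
theorem tgtStarU_false (hw : w' = u) (c : Fin 3) (h : ¬ (c = 0 ∧ t = u')) :
    tgtStarU L κ a₀ u w t z w' u' (false, c) = blockAiotaSt' L κ a₀ c u w t z * blockA L c 0 t z u' u' := by
  rw [tgtStarU_false_def, if_pos hw, if_neg h, tgtReg_false]

/-- **`hT` on an upper-`★` column**: `Σ_v tgtStarU ≤ 𝟙{w′ = u} · B'_pt^{κ,a₀,0}(u,w,t,z,u′,u′)` — the closed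
section `secEcpt` of the pointwise middle block (5.4), for every four-line family `X`.
[cite: FitznerVanDerHofstad2017, §5.1 (5.4) (arXiv:1506.07977v2 p. 48) and "Elements of the bounds" (p. 49); §6.1 (6.4) (p. 58)] -/
theorem sum_tgtStarU_le (X : DirBlockFamilyPt d) :
    ∑ v, tgtStarU L κ a₀ u w t z w' u' v ≤
      if w' = u then blockBFullpt' L X κ a₀ 0 u w t z u' u' else 0 := by
  by_cases hw : w' = u
  swap
  · simp [tgtStarU_of_ne L κ a₀ u w t z w' u' hw, if_neg hw]
  rw [if_pos hw]
  refine le_trans ?_ (sum_tgtReg_le_blockBFullpt' L κ a₀ 0 u w t z u' u' X)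
  simp only [Fintype.sum_prod_type, Fintype.sum_bool, Fin.sum_univ_three, tgtStarU_true, zero_add, add_zero]
  by_cases ht : t = u'
  · have h0 : tgtStarU L κ a₀ u w t z w' u' (false, 0) = tgtReg L κ a₀ 0 u w t z u' u' (true, 0) := by
      rw [tgtStarU_false_def, if_pos hw, if_pos (⟨rfl, ht⟩ : (0 : Fin 3) = 0 ∧ t = u')]
    have h1 : tgtStarU L κ a₀ u w t z w' u' (false, 1) = tgtReg L κ a₀ 0 u w t z u' u' (false, 1) := by
      rw [tgtStarU_false L κ a₀ u w t z w' u' hw 1 (fun h => absurd h.1 (by decide)), tgtReg_false]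
    have h2 : tgtStarU L κ a₀ u w t z w' u' (false, 2) = tgtReg L κ a₀ 0 u w t z u' u' (false, 2) := by
      rw [tgtStarU_false L κ a₀ u w t z w' u' hw 2 (fun h => absurd h.1 (by decide)), tgtReg_false]
    rw [h0, h1, h2]
    calc tgtReg L κ a₀ 0 u w t z u' u' (true, 0) + tgtReg L κ a₀ 0 u w t z u' u' (false, 1) +
          tgtReg L κ a₀ 0 u w t z u' u' (false, 2)
        = tgtReg L κ a₀ 0 u w t z u' u' (true, 0) +
            (tgtReg L κ a₀ 0 u w t z u' u' (false, 1) + tgtReg L κ a₀ 0 u w t z u' u' (false, 2)) := by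
          rw [add_assoc]
      _ ≤ (tgtReg L κ a₀ 0 u w t z u' u' (true, 0) + tgtReg L κ a₀ 0 u w t z u' u' (true, 1) +
            tgtReg L κ a₀ 0 u w t z u' u' (true, 2)) +
          (tgtReg L κ a₀ 0 u w t z u' u' (false, 0) + tgtReg L κ a₀ 0 u w t z u' u' (false, 1) +
            tgtReg L κ a₀ 0 u w t z u' u' (false, 2)) := by
          refine add_le_add ?_ ?_
          · rw [add_assoc]; exact le_self_add
          · rw [add_assoc]; exact le_add_self
  · have hc : ∀ c : Fin 3, tgtStarU L κ a₀ u w t z w' u' (false, c) = tgtReg L κ a₀ 0 u w t z u' u' (false, c) :=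
      fun c => by rw [tgtStarU_false L κ a₀ u w t z w' u' hw c (fun h => ht h.2), tgtReg_false]
    rw [hc, hc, hc]
    exact le_add_self

/-- `hT` over any sub-family of variants (e.g. the admissible ones).
[cite: FitznerVanDerHofstad2017, §5.1 (5.4) (arXiv:1506.07977v2 p. 48); §6.1 (6.4) (p. 58)] -/
theorem sum_filter_tgtStarU_le (X : DirBlockFamilyPt d) (P : Bool × Fin 3 → Prop) [DecidablePred P] :
    ∑ v ∈ Finset.univ.filter P, tgtStarU L κ a₀ u w t z w' u' v ≤
      if w' = u then blockBFullpt' L X κ a₀ 0 u w t z u' u' else 0 :=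
  (Finset.sum_le_sum_of_subset (Finset.filter_subset _ _)).trans (sum_tgtStarU_le L κ a₀ u w t z w' u' X)

/-- `hT` at the FIRST junction: with the start-letter prefix `P^{S,a₀}(u_0,w_0)` on every target.
[cite: FitznerVanDerHofstad2017, §6.1 (6.4)–(6.10) (arXiv:1506.07977v2 pp. 58–59); §5.1 (5.4) (p. 48)] -/
theorem sum_filter_blockPS_mul_tgtStarU_le (X : DirBlockFamilyPt d) (P : Bool × Fin 3 → Prop) [DecidablePred P]
    (S : ℝ≥0∞) :
    ∑ v ∈ Finset.univ.filter P, S * tgtStarU L κ a₀ u w t z w' u' v ≤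
      S * (if w' = u then blockBFullpt' L X κ a₀ 0 u w t z u' u' else 0) := by
  rw [← Finset.mul_sum]
  exact mul_le_mul' le_rfl (sum_filter_tgtStarU_le L κ a₀ u w t z w' u' X P)

end Targets

end Literature.Probability.FitznerVanDerHofstad2017.NobleBlocks

/-! ### C. The dispatch -/

namespace Literature.Probability.FitznerVanDerHofstad2017

open Literature.Barriers.CriticalPhenomena Literature.Probability.Percolation
open Literature.Probability.LatticeModels Literature.Combinatorics.SimpleGraph _root_.SimpleGraph
open _root_.MeasureTheory
open Literature.Probability.FitznerVanDerHofstad2017.NobleBlocks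
open Literature.Probability.FitznerVanDerHofstad2017.NobleBlocks.LenIdx

variable {d : ℕ}

section Packages

variable (p : unitInterval) (M : ℕ) (x : Site d) (b : Fin (M + 2) → Site d × Site d) (w t z : Fin (M + 2) → Site d)
  (a : Fin (M + 2) → Fin 3 ⊕ Unit) (c : Fin 3 ⊕ Unit) (τ : Fin (M + 1) → Bool × Fin 3)

local notation "𝐋" => Letters.perc d p

/-- **`pkg` at a MIDDLE junction `k = i₀ + 1 ≤ M` below a closed level** (`a_k = a₀` regular, `a_{k+1} = ★`), for
an admissible variant (`(τ i).1 = false`): a package with target `tgtStarU 𝐋 κ a₀ (u_k,w_k,t_k,z_k,w_{k+1},u_{k+1})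
(τ i)`.  Off the closed section `w_{k+1} = u_k` the piece is empty (`JFacts.pin_closedU`); on it the inner class
and the pin `t_k = u_{k+1}` route to `NobleBoundsNMidStar.nonempty_jPkg_closedU_two / _one`,
`NobleBoundsNMidStarZero.nonempty_jPkg_closedU_zero_one / _zero / _zero_zero_zero' / _pin`.
[cite: FitznerVanDerHofstad2017, §6.1 (6.4) "Case a = 0 / a = 1 / a ≥ 2" × "Case b = 0 / 1 / ≥ 2" (arXiv:1506.07977v2 pp. 58–59); §5.1 (5.4) (p. 48) and "Elements of the bounds" (p. 49); (4.58), (4.62), (4.64) (pp. 41–42)] -/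
theorem nonempty_jPkg_mid_starU (i i₀ : Fin (M + 1)) (hk : i₀.succ = i.castSucc) (κ : Fin d × Bool)
    (hb : (b i.castSucc).2 = (b i.castSucc).1 + stepVec κ) (a₀ : Fin 3) (ha : a i.castSucc = Sum.inl a₀)
    {u₀ : Unit} (ha' : a i.succ = Sum.inr u₀) (hσ : (τ i).1 = false) :
    Nonempty (JPkg p (jctx M x b w t z a τ i.castSucc) (JFacts M x b w t z a c τ)
      (tgtStarU 𝐋 κ a₀ (b i.castSucc).1 (w i.castSucc) (t i.castSucc) (z i.castSucc) (w i.succ) (b i.succ).1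
        (τ i))) := by
  have h3 : ∀ e : Fin 3, e = 0 ∨ e = 1 ∨ e = 2 := by decide
  -- off the closed section the piece is empty
  by_cases hw : w i.succ = (b i.castSucc).1
  swap
  · exact ⟨JPkg.vacuous p _ _ (fun ω K₀ hF => hw (hF.w_succ_eq_u_of_closedU i ha')) _⟩
  rcases h3 (τ i).2 with hc | hc | hc
  · have hv : τ i = (false, 0) := Prod.ext hσ hc
    by_cases hty : t i.castSucc = (b i.succ).1
    · -- on the pin: `z_k = t_k` or the piece is empty
      by_cases hzt : z i.castSucc = t i.castSucc
      swap
      · exact nonempty_jPkg_of_innerClass_zero_ne p c _ i hc (Ne.symm hzt) _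
      obtain ⟨P⟩ := nonempty_jPkg_closedU_pin p M x b w t z a c τ i i₀ hk κ hb hc a₀ ha ha' hty
      refine ⟨P.mono (le_of_eq ?_)⟩
      rw [hv, tgtStarU_pin 𝐋 κ a₀ _ _ _ _ _ _ hw hty, hzt, kd_self, one_mul, ← hty, sub_self, blockPS_zero,
        kd_self, one_mul]
      simp [Letters.pdbc]
    · rw [hv, tgtStarU_false 𝐋 κ a₀ _ _ _ _ _ _ hw 0 (fun h => hty h.2)]
      by_cases ha0 : a₀ = 0
      · subst ha0
        exact nonempty_jPkg_closedU_zero_zero_zero' p M x b w t z a c τ i i₀ hk κ hb hc ha ha' hty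
      · rw [blockAiotaSt'_of_ne 𝐋 κ (a := a₀) (b := 0) fun h => ha0 h.1]
        exact nonempty_jPkg_closedU_zero p M x b w t z a c τ i i₀ hk κ hb hc a₀ ha ha0 ha' hty
  · have hv : τ i = (false, 1) := Prod.ext hσ hc
    rw [hv, tgtStarU_false 𝐋 κ a₀ _ _ _ _ _ _ hw 1 (fun h => absurd h.1 (by decide)),
      blockAiotaSt'_of_ne 𝐋 κ (a := a₀) (b := 1) fun h => absurd h.2 (by decide)]
    by_cases ha0 : a₀ = 0
    · subst ha0
      exact nonempty_jPkg_closedU_zero_one p M x b w t z a c τ i i₀ hk κ hb hc ha ha'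
    · exact nonempty_jPkg_closedU_one p M x b w t z a c τ i i₀ hk κ hb hc a₀ ha ha0 ha'
  · have hv : τ i = (false, 2) := Prod.ext hσ hc
    rw [hv, tgtStarU_false 𝐋 κ a₀ _ _ _ _ _ _ hw 2 (fun h => absurd h.1 (by decide)),
      blockAiotaSt'_of_ne 𝐋 κ (a := a₀) (b := 2) fun h => absurd h.2 (by decide)]
    exact nonempty_jPkg_closedU_two p M x b w t z a c τ i i₀ hk κ hb hc a₀ ha ha'

/-- **`pkg` at the FIRST junction below a closed level** (`a_0 = a₀`, `a_1 = ★`), admissible variant: the same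
dispatch behind the start letter `P^{S,a₀}(u_0,w_0)`, onto `NobleBoundsNFirstStar.nonempty_jPkg_firstStar'`
(off the pin, inner class generic), `…_firstStar_one / _two` (inner class `1`, `2`), `…_firstStar_pin`.
[cite: FitznerVanDerHofstad2017, §6.1 (6.4)–(6.10) and the Cases a, b ∈ {0, 1, ≥ 2} (arXiv:1506.07977v2 pp. 58–59); §5.1 (5.4) (p. 48) and "Elements of the bounds" (p. 49); (4.58), (4.62), (4.64) (pp. 41–42)] -/
theorem nonempty_jPkg_first_starU (κ : Fin d × Bool)
    (hb : (b (0 : Fin (M + 1)).castSucc).2 = (b (0 : Fin (M + 1)).castSucc).1 + stepVec κ) (a₀ : Fin 3)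
    (ha : a (0 : Fin (M + 1)).castSucc = Sum.inl a₀) {u₀ : Unit} (ha' : a (0 : Fin (M + 1)).succ = Sum.inr u₀)
    (hσ : (τ 0).1 = false) :
    Nonempty (JPkg p (jctx M x b w t z a τ (0 : Fin (M + 1)).castSucc) (JFacts M x b w t z a c τ)
      (blockPS 𝐋 a₀ (b (0 : Fin (M + 1)).castSucc).1 (w (0 : Fin (M + 1)).castSucc) *
        tgtStarU 𝐋 κ a₀ (b (0 : Fin (M + 1)).castSucc).1 (w (0 : Fin (M + 1)).castSucc)
          (t (0 : Fin (M + 1)).castSucc) (z (0 : Fin (M + 1)).castSucc) (w (0 : Fin (M + 1)).succ)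
          (b (0 : Fin (M + 1)).succ).1 (τ 0))) := by
  have h3 : ∀ e : Fin 3, e = 0 ∨ e = 1 ∨ e = 2 := by decide
  by_cases hw : w (0 : Fin (M + 1)).succ = (b (0 : Fin (M + 1)).castSucc).1
  swap
  · exact ⟨JPkg.vacuous p _ _ (fun ω K₀ hF => hw (hF.w_succ_eq_u_of_closedU 0 ha')) _⟩
  rcases h3 (τ 0).2 with hc | hc | hc
  · have hv : τ 0 = (false, 0) := Prod.ext hσ hc
    by_cases hty : t (0 : Fin (M + 1)).castSucc = (b (0 : Fin (M + 1)).succ).1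
    · by_cases hzt : z (0 : Fin (M + 1)).castSucc = t (0 : Fin (M + 1)).castSucc
      swap
      · exact nonempty_jPkg_of_innerClass_zero_ne p c _ 0 hc (Ne.symm hzt) _
      obtain ⟨P⟩ := nonempty_jPkg_firstStar_pin p M x b w t z a c τ κ hb hc a₀ ha ha' hty
      refine ⟨P.mono (le_of_eq ?_)⟩
      rw [hv, tgtStarU_pin 𝐋 κ a₀ _ _ _ _ _ _ hw hty, hzt, kd_self, one_mul, ← hty, sub_self, blockPS_zero,
        kd_self, one_mul]
      simp [Letters.pdbc]
    · rw [hv, tgtStarU_false 𝐋 κ a₀ _ _ _ _ _ _ hw 0 (fun h => hty h.2)]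
      exact nonempty_jPkg_firstStar' p M x b w t z a c τ κ hb 0 hc a₀ ha ha' hty
  · have hv : τ 0 = (false, 1) := Prod.ext hσ hc
    rw [hv, tgtStarU_false 𝐋 κ a₀ _ _ _ _ _ _ hw 1 (fun h => absurd h.1 (by decide)),
      blockAiotaSt'_of_ne 𝐋 κ (a := a₀) (b := 1) fun h => absurd h.2 (by decide)]
    exact nonempty_jPkg_firstStar_one p M x b w t z a c τ κ hb hc a₀ ha ha'
  · have hv : τ 0 = (false, 2) := Prod.ext hσ hc
    rw [hv, tgtStarU_false 𝐋 κ a₀ _ _ _ _ _ _ hw 2 (fun h => absurd h.1 (by decide)),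
      blockAiotaSt'_of_ne 𝐋 κ (a := a₀) (b := 2) fun h => absurd h.2 (by decide)]
    exact nonempty_jPkg_firstStar_two p M x b w t z a c τ κ hb hc a₀ ha ha'

end Packages

end Literature.Probability.FitznerVanDerHofstad2017

end
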